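import Mathlib
import Literature.MathematicalPhysics.QuantumManyBody.PeriodicBoseGas
import Literature.MathematicalPhysics.QuantumManyBody.BoseGasStructureFactor
import Literature.MathematicalPhysics.QuantumManyBody.PeriodicBoseGasMomentumSector

/-!
# Sketch — crux idea `stable-fraction-square-completion` for StaticResponseBound
(stmt-AtomisticToContinuum-12057; crux-ideate round 1, ideator 2)

Typed first lemma and the two statements it connects. Nothing here is proved; everything must
elaborate over existing declarations (`PeriodicTrialState`, `periodicEnergy`,
`periodicGroundStateEnergy`, `cellN`, `sideLength`, `scatteringLength`, `densityWave`).

Notation (ħ = 2m = 1): `p = 2πk/L`, `C(X) = ∑ⱼ cos(p·xⱼ)` (the crux's perturbation),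
`|ρ_p(X)|² = ‖densityWave N L k X‖² = ∑_{i,j} cos(p·(xᵢ-xⱼ)) = C² + S²`.
The SOFTENED energy of a periodic trial state is `⟨Φ, (H - (g/L³)(|ρ_p|² - N)) Φ⟩`: the Bose gas
plus a mean-field ATTRACTION of strength `g/L³` in the single mode `p` (two-body multiplication
operator `-(g/L³) ∑_{i≠j} cos(p·(xᵢ-xⱼ))`; no Fourier transform of `v` is needed, hard cores allowed).
-/

namespace Summit.AtomisticToContinuum.BoseEinsteinCondensation.Cruxes.StaticResponseBound.StableFractionSquare

open MeasureTheory
open Literature.MathematicalPhysics.QuantumManyBody.BoseGas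

noncomputable section

/-- `⟨Φ, (H − (g/L³)(|ρ_p|² − N)) Φ⟩` as a real number (finite-energy `Φ` intended). -/
def softenedEnergy (v : ℝ → ENNReal) {N : ℕ} {L : ℝ} (g : ℝ) (k : Fin 3 → ℤ)
    (Φ : PeriodicTrialState N L) : ℝ :=
  (periodicEnergy v Φ).toReal -
    g / L ^ 3 * ∫ X in cellN N L, (‖densityWave N L k X‖ ^ 2 - N) * ‖Φ.ψ X‖ ^ 2

/-- The crux's linear functional `t ↦ t ∫ C |Ψ|²`, `C = ∑ⱼ cos(p·xⱼ)` (verbatim the crux's integrand). -/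
def densityWaveMean {N : ℕ} (L : ℝ) (k : Fin 3 → ℤ) (Ψ : PeriodicTrialState N L) : ℝ :=
  ∫ X in cellN N L, (∑ j, Real.cos (2 * Real.pi / L * ∑ i, (k i : ℝ) * X j i)) * ‖Ψ.ψ X‖ ^ 2

/-- FIRST LEMMA (pure algebra: normalisation + Jensen + completing one square).
If `E'` is a lower bound of the softened energy, then for every coupling `t` and every
finite-energy `Ψ`: `E' − gN/L³ − t²L³/(4g) ≤ ⟨Ψ,HΨ⟩ + t⟨C⟩_Ψ`.
Proof sketch: `⟨H⟩_Ψ = softened + (g/L³)(⟨|ρ_p|²⟩_Ψ − N) ≥ E' + (g/L³)(⟨C⟩_Ψ² − N)` and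
`(g/L³)M² + tM ≥ −t²L³/(4g)`. -/
def SingleModeSquareCompletion : Prop :=
  ∀ (v : ℝ → ENNReal) (N : ℕ) (L : ℝ), 0 < L → ∀ (k : Fin 3 → ℤ) (g : ℝ), 0 < g → ∀ (E' : ℝ),
    (∀ Φ : PeriodicTrialState N L, periodicEnergy v Φ ≠ ⊤ → E' ≤ softenedEnergy v g k Φ) →
    ∀ (t : ℝ) (Ψ : PeriodicTrialState N L), periodicEnergy v Ψ ≠ ⊤ →
      E' - g * N / L ^ 3 - t ^ 2 * L ^ 3 / (4 * g) ≤
        (periodicEnergy v Ψ).toReal + t * densityWaveMean L k Ψ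

/-- (S1) SINGLE-MODE ATTRACTION STABILITY — the new object the idea reduces the crux to.
Softening the `p`-channel by the fraction `θ` of the Bogoliubov vertex `8πa + p²/(2ρ)` lowers
the ground-state energy by at most an INTENSIVE amount `D(ρa + p²)`, uniformly in `N`, `L =
(N/ρ)^{1/3}`, `k ≠ 0` (Bogoliubov: true for every θ < 1, with NEGATIVE price −θgρ(1 − S(p)) at
first order; equivalently the structure factor of the softened ground states stays O(1)). -/
def SingleModeAttractionStability : Prop :=
  ∀ v : ℝ → ENNReal, IsRepulsiveFiniteRange v → ∃ ρ₀ : ℝ, 0 < ρ₀ ∧ ∃ θ : ℝ, 0 < θ ∧ ∃ D : ℝ, 0 ≤ D ∧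
    ∀ ρ : ℝ, 0 < ρ → ρ < ρ₀ → ∀ N : ℕ, 0 < N → ∀ k : Fin 3 → ℤ, k ≠ 0 →
      ∀ Φ : PeriodicTrialState N (sideLength ρ N), periodicEnergy v Φ ≠ ⊤ →
        (periodicGroundStateEnergy v N (sideLength ρ N)).toReal
            - D * (ρ * (scatteringLength v).toReal
                    + (2 * Real.pi / sideLength ρ N) ^ 2 * ∑ i, (k i : ℝ) ^ 2)
          ≤ softenedEnergy v
              (θ * (8 * Real.pi * (scatteringLength v).toReal
                + (2 * Real.pi / sideLength ρ N) ^ 2 * (∑ i, (k i : ℝ) ^ 2) / (2 * ρ))) k Φ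

/-- COARSE STATIC RESPONSE BOUND: the crux `StaticResponseBound` verbatim, up to an additive
INTENSIVE defect `D(ρa + p²)` on the left (irrelevant for `|t| ≳ N^{-1/2}`; the crux is the case
`D = 0`). This is what (S1) + the first lemma give at once, with `C = 1/(2θ)`. -/
def CoarseStaticResponseBound : Prop :=
  ∀ v : ℝ → ENNReal, IsRepulsiveFiniteRange v → ∃ ρ₀ : ℝ, 0 < ρ₀ ∧ ∃ C : ℝ, 0 < C ∧ ∃ D : ℝ, 0 ≤ D ∧
    ∀ ρ : ℝ, 0 < ρ → ρ < ρ₀ → ∀ N : ℕ, 0 < N → ∀ k : Fin 3 → ℤ, k ≠ 0 → ∀ t : ℝ,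
      ∀ Ψ : PeriodicTrialState N (sideLength ρ N), periodicEnergy v Ψ ≠ ⊤ →
        (periodicGroundStateEnergy v N (sideLength ρ N)).toReal
            - D * (ρ * (scatteringLength v).toReal
                    + (2 * Real.pi / sideLength ρ N) ^ 2 * ∑ i, (k i : ℝ) ^ 2)
            - C * t ^ 2 * N / max (ρ * (scatteringLength v).toReal)
                ((2 * Real.pi / sideLength ρ N) ^ 2 * ∑ i, (k i : ℝ) ^ 2)
          ≤ (periodicEnergy v Ψ).toReal + t * densityWaveMean (sideLength ρ N) k Ψ

/-- The reduction the card claims is elementary (first lemma + `L³ = N/ρ` + `8πρa + p²/2 ≥ max(ρa,p²)/2`). -/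
def CoarseReduction : Prop :=
  SingleModeSquareCompletion → SingleModeAttractionStability → CoarseStaticResponseBound

/-- ENERGY-CONTROLLED STRUCTURE FACTOR (the operator content of (S1), used for the window
`|t| ≲ N^{-1/2}` through the discriminant form of the crux): in ANY finite-energy periodic state
the density fluctuation at mode `p` exceeds the softened-ground-state level by at most the
excitation energy divided by `θ(8πρa + p²/2)`:
`(g/L³) ∫ |ρ_p|²|Φ|² ≤ ⟨Φ,HΦ⟩ − E₀ + D(ρa+p²) + gN/L³`. Literally a rewriting of (S1). -/
def EnergyControlledStructureFactor : Prop :=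
  ∀ v : ℝ → ENNReal, IsRepulsiveFiniteRange v → ∃ ρ₀ : ℝ, 0 < ρ₀ ∧ ∃ θ : ℝ, 0 < θ ∧ ∃ D : ℝ, 0 ≤ D ∧
    ∀ ρ : ℝ, 0 < ρ → ρ < ρ₀ → ∀ N : ℕ, 0 < N → ∀ k : Fin 3 → ℤ, k ≠ 0 →
      ∀ Φ : PeriodicTrialState N (sideLength ρ N), periodicEnergy v Φ ≠ ⊤ →
        θ * (8 * Real.pi * (scatteringLength v).toReal
              + (2 * Real.pi / sideLength ρ N) ^ 2 * (∑ i, (k i : ℝ) ^ 2) / (2 * ρ))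
            / sideLength ρ N ^ 3
            * ∫ X in cellN N (sideLength ρ N), ‖densityWave N (sideLength ρ N) k X‖ ^ 2 * ‖Φ.ψ X‖ ^ 2
          ≤ (periodicEnergy v Φ).toReal - (periodicGroundStateEnergy v N (sideLength ρ N)).toReal
            + D * (ρ * (scatteringLength v).toReal
                    + (2 * Real.pi / sideLength ρ N) ^ 2 * ∑ i, (k i : ℝ) ^ 2)
            + θ * (8 * Real.pi * (scatteringLength v).toReal
                + (2 * Real.pi / sideLength ρ N) ^ 2 * (∑ i, (k i : ℝ) ^ 2) / (2 * ρ)) * N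
              / sideLength ρ N ^ 3

/-! ### The window (t → 0): typed inputs (T1), (T2) and the claimed reduction shape -/

/-- (T1) SOFTENED-FAMILY HYPERUNIFORM STABILITY: along the softening path the price is the sharp
one, `E′_θ ≥ E₀ + θρg_p(1 − C_H·|p|/√(ρa))`, i.e. the softened ground states stay hyperuniform
`S′(p) ≤ C_H |p|/√(ρa)` for `|p| ≤ M₀√(ρa)` (⇐ a Landau bound at the single sector `p` for each
softened Hamiltonian, by f-sum + Feynman). -/
def SoftenedHyperuniformStability : Prop :=
  ∀ v : ℝ → ENNReal, IsRepulsiveFiniteRange v → ∀ M₀ : ℝ, 0 < M₀ →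
    ∃ ρ₀ : ℝ, 0 < ρ₀ ∧ ∃ θ : ℝ, 0 < θ ∧ ∃ C_H : ℝ, 0 < C_H ∧
    ∀ ρ : ℝ, 0 < ρ → ρ < ρ₀ → ∀ N : ℕ, 0 < N → ∀ k : Fin 3 → ℤ, k ≠ 0 →
      Real.sqrt ((2 * Real.pi / sideLength ρ N) ^ 2 * ∑ i, (k i : ℝ) ^ 2)
          ≤ M₀ * Real.sqrt (ρ * (scatteringLength v).toReal) →
      ∀ Φ : PeriodicTrialState N (sideLength ρ N), periodicEnergy v Φ ≠ ⊤ →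
        (periodicGroundStateEnergy v N (sideLength ρ N)).toReal
            + θ * (8 * Real.pi * (scatteringLength v).toReal
                + (2 * Real.pi / sideLength ρ N) ^ 2 * (∑ i, (k i : ℝ) ^ 2) / (2 * ρ)) * ρ
              * (1 - C_H * Real.sqrt ((2 * Real.pi / sideLength ρ N) ^ 2 * ∑ i, (k i : ℝ) ^ 2)
                        / Real.sqrt (ρ * (scatteringLength v).toReal))
          ≤ softenedEnergy v
              (θ * (8 * Real.pi * (scatteringLength v).toReal
                + (2 * Real.pi / sideLength ρ N) ^ 2 * (∑ i, (k i : ℝ) ^ 2) / (2 * ρ))) k Φ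

/-- (T2) SECTOR FLOOR (Landau with saturation): every non-zero total-momentum sector of the torus
gas lies `θ_L √(ρa) · min(|q|, M₀√(ρa))` above `E₀` (the `|q| ≤ M₀√(ρa)` half is
`LandauSectorBound`, stmt-AtomisticToContinuum-9091, in min–max form over `momentumSectorEnergy`). -/
def SectorFloor : Prop :=
  ∀ v : ℝ → ENNReal, IsRepulsiveFiniteRange v → ∀ M₀ : ℝ, 0 < M₀ →
    ∃ θL : ℝ, 0 < θL ∧ ∃ ρ₀ : ℝ, 0 < ρ₀ ∧ ∀ ρ : ℝ, 0 < ρ → ρ < ρ₀ → ∀ N : ℕ, 0 < N →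
      ∀ m : Fin 3 → ℤ, m ≠ 0 →
        periodicGroundStateEnergy v N (sideLength ρ N)
            + ENNReal.ofReal (θL * Real.sqrt (ρ * (scatteringLength v).toReal)
                * min (2 * Real.pi / sideLength ρ N
                        * ‖(WithLp.toLp 2 fun t => (m t : ℝ) : EuclideanSpace ℝ (Fin 3))‖)
                      (M₀ * Real.sqrt (ρ * (scatteringLength v).toReal)))
          ≤ momentumSectorEnergy v N (sideLength ρ N)
              ((2 * Real.pi / sideLength ρ N) • (WithLp.toLp 2 fun t => (m t : ℝ)))

/-- The crux restricted to the phonon + crossover branch `|p| ≤ M₀√(ρa)` (verbatim the crux's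
inequality otherwise; `C` may depend on `M₀`). -/
def StaticResponseBoundPhonon : Prop :=
  ∀ v : ℝ → ENNReal, IsRepulsiveFiniteRange v → ∀ M₀ : ℝ, 0 < M₀ →
    ∃ ρ₀ : ℝ, 0 < ρ₀ ∧ ∃ C : ℝ, 0 < C ∧
    ∀ ρ : ℝ, 0 < ρ → ρ < ρ₀ → ∀ N : ℕ, ∀ k : Fin 3 → ℤ, k ≠ 0 →
      Real.sqrt ((2 * Real.pi / sideLength ρ N) ^ 2 * ∑ i, (k i : ℝ) ^ 2)
          ≤ M₀ * Real.sqrt (ρ * (scatteringLength v).toReal) →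
      ∀ t : ℝ, ∀ Ψ : PeriodicTrialState N (sideLength ρ N), periodicEnergy v Ψ ≠ ⊤ →
        (periodicGroundStateEnergy v N (sideLength ρ N)).toReal
            - C * t ^ 2 * N / max (ρ * (scatteringLength v).toReal)
                ((2 * Real.pi / sideLength ρ N) ^ 2 * ∑ i, (k i : ℝ) ^ 2)
          ≤ (periodicEnergy v Ψ).toReal + t * densityWaveMean (sideLength ρ N) k Ψ

/-- Shape of the window closure claimed by the card (square completion + energy-controlled
structure factor + bilinear sector reduction + discriminant). -/
def WindowReduction : Prop :=
  SingleModeSquareCompletion → SoftenedHyperuniformStability → SectorFloor → StaticResponseBoundPhonon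

end

end Summit.AtomisticToContinuum.BoseEinsteinCondensation.Cruxes.StaticResponseBound.StableFractionSquare
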